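import Mathlib
import Summits.ResolutionOfSingularities.ResolutionOfSingularities.Theorems.HomologicalConductorPersistenceCyclicQuotientCharFree
import Summits.ResolutionOfSingularities.ResolutionOfSingularities.Theorems.HomologicalConductorPersistenceAuslanderAddCover
import HarnessLib

/-!
# Rung S-2 `PersistenceSurface` (stmt-ResolutionOfSingularities-19970) — AUSLANDER–HERZOG for `k[u,v]^{(n; 1,q)}`
# in EVERY CHARACTERISTIC (`Ω²(mod U) ⊆ add_U k[u,v]`, the `Sat₄` certificate shape; K-PCC F6 «Herzog-for-μ_n»;
# res-L1-w44b-stub-1 gen 6)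

Route `ResolutionOfSingularities/HomologicalConductor`, chain W4.4b (cell res-hironaka).  `[OURS · L1 w44b]` replaces
the role of no printed item; NOT a statement of the manuscript under review (Hironaka 2017), nothing here is
attributed to its author; folklore algebra (Auslander 1986 / Herzog 1978 mechanism), AI-written (weaker than
expert review).

## Content

Stub-4's part 16 (`…PersistenceCyclicQuotientAddCover`) discharged the three hypotheses of part 15's group-free
Herzog lemma (`…PersistenceAuslanderAddCover.isRetractOfPower_restrictScalars_of_isSyzygy_two`: a `U`-linear
retraction `ρ`, the Frobenius hypothesis «`Hom_U(V,U)` finitely generated projective over `V`», `1 ∈ ca³(V)`) at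
`1/n(1,q)` through a primitive `n`-th root of unity and `n ∈ kˣ`.  res-L1-w44b-lead-1's memo K-PCC v5 §10 F6 asks
for the `μ_n` version in every characteristic («the RUNG quantifies over all `p`»).  With the `ZMod n`-grading of
`…CyclicQuotientCharFree` and the Reynolds-free perfect pairing of `…GradedTransferPairing` all three hypotheses
hold for EVERY field `k`:

* `isNoetherianRing_degreeZero` — `U` (the degree-`0` subalgebra) is noetherian; `exists_reynolds_charFree` — the
  retraction; `finite_projective_coind_charFree` — the Frobenius hypothesis (`gcd(q,n) = 1`).
* **`isRetractOfPower_of_isSyzygy_two_charFree`** — AUSLANDER–HERZOG for `U = k[u,v]^{(n;1,q)}`, `k` ANY field: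
  every second syzygy module of a finitely generated `U`-module is a `U`-direct summand of some `k[u,v]ᵐ|_U`;
  `isRetractOfPower_of_isSyzygy_three_charFree` — `Ω³(mod U) ⊆ add_U (Ω(k[u,v]|_U) ⊕ U)`.
* **`cohomologyAnnihilator_eq_four_charFree`**, `cohomologyAnnihilatorOfDegree_eq_four_charFree` — the `Sat₄`
  certificate shape of part 16 with NO root of unity and NO `n ∈ kˣ`: two decompositions (`K_V ∈ add(D ⊕ U)`,
  `D ∈ add(K_D ⊕ U)`) give `ca(U) = ca⁴(U)` and `x ∈ ca(U) ↔ x ∈ s̲ann(D)`.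

References (mechanism only): S. B. Iyengar, R. Takahashi, IMRN 2016, arXiv:1404.1476 [`IyengarTakahashi2014`];
M. Auslander, Trans. AMS 293 (1986); J. Herzog, Math. Ann. 233 (1978).
-/

noncomputable section

-- single-problem summit: the doubled namespace component `ResolutionOfSingularities` is forced
set_option linter.dupNamespace false

namespace Summit.ResolutionOfSingularities.ResolutionOfSingularities.Theorems.HomologicalConductor.PersistenceCyclicQuotientCharFree

open Finset CategoryTheory MvPolynomial Literature.RingTheory.CohomologyAnnihilator
open Summit.ResolutionOfSingularities.ResolutionOfSingularities.Theorems.NoZeno.SandwichCluster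
open Summit.ResolutionOfSingularities.ResolutionOfSingularities.Theorems.HomologicalConductor.PersistenceGradedTransfer
open Summit.ResolutionOfSingularities.ResolutionOfSingularities.Theorems.HomologicalConductor.PersistenceAuslanderAddCover

universe u

variable {k : Type u} [Field k] {n : ℕ} [NeZero n]

/-! ## The three Herzog hypotheses, every characteristic -/

/-- **A retraction** (the degree-`0` part): `ρ : k[u,v] → U` `U`-linear with `ρ ∘ algebraMap = id`, for every
field `k`. [folklore] -/
theorem exists_reynolds_charFree (q : ℕ) (U : Subalgebra k (MvPolynomial (Fin 2) k))
    (hU : ∀ p, p ∈ U ↔ weightedHomogeneousComponent (![1, (q : ZMod n)]) 0 p = p) :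
    ∃ ρ : MvPolynomial (Fin 2) k →ₗ[U] U, ∀ u, ρ (algebraMap U (MvPolynomial (Fin 2) k) u) = u := by
  obtain ⟨e, ρ, he, -, -, -, -, -, hρ⟩ := exists_grading (k := k) (n := n) q U hU
  have hinj : Function.Injective (algebraMap U (MvPolynomial (Fin 2) k)) := Subtype.val_injective
  exact ⟨ρ, fun u => hinj (by rw [hρ, he]; exact (hU u).mp u.2)⟩

/-- **`U = k[u,v]^{(n;1,q)}` is noetherian** for every field `k` (a ring retract of `k[u,v]`). [folklore] -/
theorem isNoetherianRing_degreeZero (q : ℕ) (U : Subalgebra k (MvPolynomial (Fin 2) k))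
    (hU : ∀ p, p ∈ U ↔ weightedHomogeneousComponent (![1, (q : ZMod n)]) 0 p = p) : IsNoetherianRing U := by
  obtain ⟨ρ, hρ⟩ := exists_reynolds_charFree (k := k) (n := n) q U hU
  exact isNoetherianRing_of_retract ρ hρ

/-- **The Frobenius hypothesis, every characteristic**: `Hom_U(k[u,v], U)` is a finitely generated projective
`k[u,v]`-module (`gcd(q,n) = 1`; graded perfect pairing). [OURS · L1 w44b] -/
theorem finite_projective_coind_charFree {q : ℕ} (hq : q.Coprime n) (U : Subalgebra k (MvPolynomial (Fin 2) k))
    (hU : ∀ p, p ∈ U ↔ weightedHomogeneousComponent (![1, (q : ZMod n)]) 0 p = p) :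
    Module.Finite (MvPolynomial (Fin 2) k)
        (((ModuleCat.restrictScalars (algebraMap U (MvPolynomial (Fin 2) k))).obj
          (ModuleCat.of (MvPolynomial (Fin 2) k) (MvPolynomial (Fin 2) k))) →ₗ[U] U) ∧
      Module.Projective (MvPolynomial (Fin 2) k)
        (((ModuleCat.restrictScalars (algebraMap U (MvPolynomial (Fin 2) k))).obj
          (ModuleCat.of (MvPolynomial (Fin 2) k) (MvPolynomial (Fin 2) k))) →ₗ[U] U) := by
  obtain ⟨e, ρ, he, he_sum, he_proj, he_mul, he_one, he_zero, hρ⟩ := exists_grading (k := k) (n := n) q U hU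
  refine finite_projective_coind_of_graded e he_sum he_proj he_mul he_one he_zero Subtype.val_injective
    (fun y P hP hP1 => ?_) ρ hρ
  obtain ⟨m, hm, hmP⟩ := hbig_weighted (k := k) hq y P hP hP1
  exact ⟨m, by rw [he]; exact hm, hmP⟩

/-! ## Auslander–Herzog and the `Sat₄` shape, every characteristic -/

/-- **AUSLANDER–HERZOG for `U = k[u,v]^{(n;1,q)}` in EVERY characteristic** (`gcd(q,n) = 1`, `k` ANY field,
`p ∣ n` allowed): every second syzygy module of a finitely generated `U`-module is a `U`-direct summand of
`k[u,v]ᵐ|_U` for some `m` — `Ω²(mod U) ⊆ add_U k[u,v]`.  Part 16's theorem minus the primitive root and `n ∈ kˣ`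
(K-PCC F6 «Herzog-for-μ_n»). [OURS · L1 w44b] -/
theorem isRetractOfPower_of_isSyzygy_two_charFree {q : ℕ} (hq : q.Coprime n)
    (U : Subalgebra k (MvPolynomial (Fin 2) k))
    (hU : ∀ p, p ∈ U ↔ weightedHomogeneousComponent (![1, (q : ZMod n)]) 0 p = p)
    (M K : ModuleCat.{u} U) (hM : Module.Finite U M) (hK : IsSyzygy 2 M K) :
    IsRetractOfPower ((restrictScalarsFunctor U (MvPolynomial (Fin 2) k)).obj
      (ModuleCat.of (MvPolynomial (Fin 2) k) (MvPolynomial (Fin 2) k))) K := by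
  obtain ⟨ρ, hρ⟩ := exists_reynolds_charFree (k := k) (n := n) q U hU
  obtain ⟨hfin, hproj⟩ := finite_projective_coind_charFree (k := k) (n := n) hq U hU
  haveI := hfin
  haveI := hproj
  have hV : (1 : MvPolynomial (Fin 2) k) ∈ cohomologyAnnihilatorOfDegree (MvPolynomial (Fin 2) k) 3 := by
    rw [cohomologyAnnihilatorOfDegree_mvPolynomial_eq_top k 2]
    exact Submodule.mem_top
  exact isRetractOfPower_restrictScalars_of_isSyzygy_two ρ (by simpa using hρ 1) hV M K hM hK

/-- **`Ω³(mod U) ⊆ add_U (Ω(k[u,v]|_U) ⊕ U)` in every characteristic**, for any first `U`-syzygy module `K_V`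
of `k[u,v]|_U`. [OURS · L1 w44b] -/
theorem isRetractOfPower_of_isSyzygy_three_charFree {q : ℕ} (hq : q.Coprime n)
    (U : Subalgebra k (MvPolynomial (Fin 2) k))
    (hU : ∀ p, p ∈ U ↔ weightedHomogeneousComponent (![1, (q : ZMod n)]) 0 p = p) {KV : ModuleCat.{u} U}
    (hKV : IsSyzygy 1 ((restrictScalarsFunctor U (MvPolynomial (Fin 2) k)).obj
      (ModuleCat.of (MvPolynomial (Fin 2) k) (MvPolynomial (Fin 2) k))) KV)
    (M K : ModuleCat.{u} U) (hM : Module.Finite U M) (hK : IsSyzygy 3 M K) :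
    IsRetractOfPower (ModuleCat.of U (KV × U)) K :=
  isRetractOfPower_of_isSyzygy_succ_of_cover (isRetractOfPower_of_isSyzygy_two_charFree hq U hU) hKV hM hK

/-- **THE `Sat₄` CERTIFICATE SHAPE at `1/n(1,q)`, every characteristic.**  A first `U`-syzygy `K_V` of
`k[u,v]|_U` with `K_V ∈ add (D ⊕ U)` for a finitely generated `D`, and a first syzygy `K_D` of `D` with
`D ∈ add (K_D ⊕ U)`, give `ca(U) = ca⁴(U)` and `x ∈ ca(U) ↔ x ∈ s̲ann(D)` — no root of unity, no `n ∈ kˣ`.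
[OURS · L1 w44b] -/
theorem cohomologyAnnihilator_eq_four_charFree {q : ℕ} (hq : q.Coprime n)
    (U : Subalgebra k (MvPolynomial (Fin 2) k))
    (hU : ∀ p, p ∈ U ↔ weightedHomogeneousComponent (![1, (q : ZMod n)]) 0 p = p)
    {KV D KD : ModuleCat.{u} U} [Module.Finite U D]
    (hKV : IsSyzygy 1 ((restrictScalarsFunctor U (MvPolynomial (Fin 2) k)).obj
      (ModuleCat.of (MvPolynomial (Fin 2) k) (MvPolynomial (Fin 2) k))) KV)
    (hKVD : IsRetractOfPower (ModuleCat.of U (D × U)) KV)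
    (hKD : IsSyzygy 1 D KD) (hD : IsRetractOfPower (ModuleCat.of U (KD × U)) D) :
    cohomologyAnnihilator U = cohomologyAnnihilatorOfDegree U 4 ∧
      ∀ x : U, x ∈ cohomologyAnnihilator U ↔ StablyAnnihilates U x D := by
  haveI := isNoetherianRing_degreeZero (k := k) (n := n) q U hU
  exact ⟨cohomologyAnnihilator_eq_of_cover_of_omegaStable 2 (isRetractOfPower_of_isSyzygy_two_charFree hq U hU) hKV
      hKVD hKD hD,
    mem_cohomologyAnnihilator_iff_stablyAnnihilates_of_cover_of_omegaStable 2
      (isRetractOfPower_of_isSyzygy_two_charFree hq U hU) hKV hKVD hKD hD⟩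

/-- Levelled form, every characteristic: under the same two decompositions `caᵐ(U) = ca⁴(U)` for every `m ≥ 4`,
and `x ∈ ca⁴(U) ↔ x ∈ s̲ann(D)`. [OURS · L1 w44b] -/
theorem cohomologyAnnihilatorOfDegree_eq_four_charFree {q : ℕ} (hq : q.Coprime n)
    (U : Subalgebra k (MvPolynomial (Fin 2) k))
    (hU : ∀ p, p ∈ U ↔ weightedHomogeneousComponent (![1, (q : ZMod n)]) 0 p = p)
    {KV D KD : ModuleCat.{u} U} [Module.Finite U D]
    (hKV : IsSyzygy 1 ((restrictScalarsFunctor U (MvPolynomial (Fin 2) k)).obj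
      (ModuleCat.of (MvPolynomial (Fin 2) k) (MvPolynomial (Fin 2) k))) KV)
    (hKVD : IsRetractOfPower (ModuleCat.of U (D × U)) KV)
    (hKD : IsSyzygy 1 D KD) (hD : IsRetractOfPower (ModuleCat.of U (KD × U)) D) {m : ℕ} (hm : 4 ≤ m) :
    cohomologyAnnihilatorOfDegree U m = cohomologyAnnihilatorOfDegree U 4 ∧
      ∀ x : U, x ∈ cohomologyAnnihilatorOfDegree U 4 ↔ StablyAnnihilates U x D := by
  haveI := isNoetherianRing_degreeZero (k := k) (n := n) q U hU
  exact ⟨cohomologyAnnihilatorOfDegree_eq_of_cover_of_omegaStable 2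
      (isRetractOfPower_of_isSyzygy_two_charFree hq U hU) hKV hKVD hKD hD hm,
    mem_cohomologyAnnihilatorOfDegree_iff_stablyAnnihilates_of_cover_of_omegaStable 2
      (isRetractOfPower_of_isSyzygy_two_charFree hq U hU) hKV hKVD hKD hD⟩

end Summit.ResolutionOfSingularities.ResolutionOfSingularities.Theorems.HomologicalConductor.PersistenceCyclicQuotientCharFree

end
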